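import Literature.NumberTheory.ComplexMultiplication.CMAlgebraLatticePicardExtensionSurjective
import Literature.NumberTheory.ComplexMultiplication.CMAlgebraLatticeConductorKernelBijection
import HarnessLib

/-!
# The CLASS NUMBER FORMULA for a pair of orders `Λ_2 ⊆ Λ_1` of a CM-ALGEBRA `Y = L_1 ⊕ ⋯ ⊕ L_t`:
# `#G([Λ_2]_ε) · [Λ_1^{unit} : Λ_2^{unit}] = #G([Λ_1]_ε) · #((Λ_1/C)^{unit}/(Λ_2/C)^{unit})`, `C = Λ_2:Λ_1`
# (Hertling–Larabi 2026 Thm. 8.2 (e), (f) (8.10); Neukirch (12.12) for `Λ_1 = 𝒪_K`), via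
# `#ker(G(Λ_2) → G(Λ_1)) = #ker(G([Λ_2]_ε) → G([Λ_1]_ε)) · [Λ_1^{unit} : Λ_2^{unit}]`

[node N13c] [stratum S1] [book HertlingLarabi2026 > §8 Exact sequences for an order and a smaller order > Thm. 8.2 (e), (f)]

Topic `Literature/NumberTheory/ComplexMultiplication`, namespace `Literature.NumberTheory.ComplexMultiplication`;
lane `lit-hodgefound` (Track 2 foundations library), Layer A3, seat p19 generation 32, row g32-#8 — sequel of
g32-#6 (`CMAlgebraLatticePicardExtensionSurjective`: `#G([Λ_2]_ε) = #G([Λ_1]_ε) · #ker_ε`) and g32-#7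
(`CMAlgebraLatticeConductorKernelBijection`: Thm. 8.2 (d) as a bijection), closing the counting form of HL (8.10)
∕ Neukirch (12.12).  THEOREMS ONLY: no definition, no instance, no named fact (D-0026, net
Literature debt `0`), no `sorry`.

VOCABULARY.  The unit group `Λ^{unit} = {u ∈ Y^{unit} | u, u⁻¹ ∈ Λ}` of an order `Λ ⊂ Y` is written as the STABILIZER
`MulAction.stabilizer Y^{unit} Λ = {u | uΛ = Λ}` of `Λ` under the action of `Y^{unit}` on lattices
(`mem_stabilizer_iff_mem_and_inv_mem`); the index `[Λ_1^{unit} : Λ_2^{unit}]` is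
`(stabilizer Λ_2).relIndex (stabilizer Λ_1)`.  The LATTICE kernel `ker(G(Λ_2) → G(Λ_1))` is the subtype of full,
invertible `K` with `K/K = Λ_2` and `Λ_1K = Λ_1`; the CLASS kernel `ker_ε` is g32-#6's subtype of `G([Λ_2]_ε)`.

## Source, VERBATIM

C. Hertling, K. Larabi, *Semigroups from full lattices in commutative ℚ-algebras*, arXiv:2602.14973 (2026)
[HertlingLarabi2026], held `paper:arxiv-2602.14973`.  §8 (chunks p0021–p0023): «**Theorem 8.2.** […] (e) The maps
in the following sequence are the natural ones, the sequence is exact,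
`1 → Λ_2^{unit} → Λ_1^{unit} → ∏_{p∈P_0}(Λ_1)_(p)^{unit}/(Λ_2)_(p)^{unit} → G([Λ_2]_ε) → G([Λ_1]_ε) → 1`. […]
(f) The group `Λ_2^{unit}` has finite index in the group `Λ_1^{unit}`. By Theorem 6.5 the groups `G([Λ_2]_ε)` and
`G([Λ_1]_ε)` are finite. The size of one of them can be calculated by the size of the other one with the
following formula, `|G([Λ_2]_ε)|/|G([Λ_1]_ε)| = |(Λ_1/C)^{unit}|/|(Λ_2/C)^{unit}| · 1/[Λ_1^{unit} : Λ_2^{unit}]` (8.10).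
*Proof:* […] (e) Claim: The group homomorphism `ker(G(Λ_2) → G(Λ_1)) → ker(G([Λ_2]_ε) → G([Λ_1]_ε))` is
surjective. Proof of the Claim: Consider `L̃ ∈ G(Λ_2)` with `[L̃]_ε ∈ ker(G([Λ_2]_ε) → G([Λ_1]_ε))`. Then
`[Λ_1L̃]_ε = [Λ_1]_ε`, so an element `a ∈ A^{unit}` with `Λ_1L̃ = aΛ_1` exists. Define `L := a⁻¹L̃`. Then
`[L]_ε = [L̃]_ε`, `L ∈ G(Λ_2)`, `Λ_1L = Λ_1`, so `L ∈ ker(G(Λ_2) → G(Λ_1))`. (□) […] First consider `a ∈ Λ_1^{unit}`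
[…] `L := ⋂ a_p(Λ_2)_(p) = ⋂ a(Λ_2)_(p) = aΛ_2 ∈ [Λ_2]_ε`. […]»

## What is proved (the part of (e)–(f) between the lattice kernel and the class kernel)

For orders `Λ_2 ⊆ Λ_1` of `Y`, the map `K ↦ [K]_ε` from the lattice kernel `ker(G(Λ_2) → G(Λ_1))` onto the class
kernel `ker_ε` (HL's Claim) has fibres the `Λ_1^{unit}`-orbits `{uK | u ∈ Λ_1^{unit}}`, each in bijection with
`Λ_1^{unit}/Λ_2^{unit}` (`uK = K ⟺ u ∈ 𝒪(K)^{unit} = Λ_2^{unit}`), whence — with `Nat.card`, no finiteness needed —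
`natCard_kerLat_eq_natCard_ker_mul_relIndex`: **`#ker(G(Λ_2) → G(Λ_1)) = #ker_ε · [Λ_1^{unit} : Λ_2^{unit}]`**.
§3 `natCard_quot_unitsModConductor_eq_natCard_kerLat`: the bijection `(Λ_1/C)^{unit}/(Λ_2/C)^{unit} ≅
ker(G(Λ_2) → G(Λ_1))` of Thm. 8.2 (d) (g32-#5/#7), counted.  §4 `natCard_quot_pic_mul_relIndex_eq`: with g32-#6
(`#G([Λ_2]_ε) = #G([Λ_1]_ε)·#ker_ε`), HL's formula (8.10) ∕ Neukirch (12.12) for arbitrary orders `Λ_2 ⊆ Λ_1` of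
`Y`: **`#G([Λ_2]_ε) · [Λ_1^{unit} : Λ_2^{unit}] = #G([Λ_1]_ε) · #((Λ_1/C)^{unit}/(Λ_2/C)^{unit})`**.

## References

* [HL26] C. Hertling, K. Larabi, *Semigroups from full lattices in commutative ℚ-algebras*, arXiv:2602.14973
  (2026), §8 Thm. 8.2 (e), (f) and proof of the Claim (chunks p0021–p0023). [cite: HertlingLarabi2026]
* [Ne99] J. Neukirch, *Algebraic Number Theory*, Grundlehren 322 (1999), I §12 Prop. (12.9), Thm. (12.12)
  (`1 → 𝒪^* → 𝒪_K^* → … → Pic(𝒪) → Pic(𝒪_K) → 1`; `h(𝒪) = h_K/[𝒪_K^* : 𝒪^*] · #(𝒪_K/𝔣)^*/#(𝒪/𝔣)^*`), identified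
  with (e), (f) in [HL26] Rem. 8.3. [cite: NeukirchANT1999]
-/

noncomputable section

open scoped Classical Pointwise nonZeroDivisors NumberField
open Module NumberField Function

namespace Literature.NumberTheory.ComplexMultiplication

open Literature.NumberTheory.Automorphic

section KernelUnitIndex

variable {t : Type} {L : t → Type} [∀ i, Field (L i)] [∀ i, NumberField (L i)]

/-! ## §1 The unit group `Λ^{unit}` of an order as the stabilizer of `Λ` -/

omit [∀ i, NumberField (L i)] in
/-- **`Λ^{unit} = {u ∈ Y^{unit} | uΛ = Λ}`: for an order `Λ`, a unit `u` of `Y` stabilises `Λ` iff `u ∈ Λ` and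
`u⁻¹ ∈ Λ`.** [cite: HertlingLarabi2026, §8 Thm. 8.2 (e) («1 → Λ_2^unit → Λ_1^unit → …»; proof: «aΛ_2 ∈ [Λ_2]_ε» for a ∈ Λ_1^unit), chunks p0021, p0023] -/
theorem mem_stabilizer_iff_mem_and_inv_mem {Λ : Submodule ℤ (Π i, L i)} (h1 : (1 : Π i, L i) ∈ Λ)
    (hΛΛ : Λ * Λ ≤ Λ) (u : (Π i, L i)ˣ) :
    u ∈ MulAction.stabilizer (Π i, L i)ˣ Λ ↔ (u : Π i, L i) ∈ Λ ∧ ((u⁻¹ : (Π i, L i)ˣ) : Π i, L i) ∈ Λ := by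
  rw [MulAction.mem_stabilizer_iff]
  constructor
  · intro h
    refine ⟨?_, ?_⟩
    · have h2 : u • (1 : Π i, L i) ∈ u • Λ := Submodule.smul_mem_pointwise_smul _ _ _ h1
      rwa [h, Units.smul_def, smul_eq_mul, mul_one] at h2
    · have h2 : (1 : Π i, L i) ∈ u • Λ := by rw [h]; exact h1
      rwa [mem_units_smul_submodule_iff, Units.smul_def, smul_eq_mul, mul_one] at h2
  · rintro ⟨hu, hu'⟩
    refine le_antisymm (fun x hx => ?_) (fun x hx => ?_)
    · rw [mem_units_smul_submodule_iff, Units.smul_def, smul_eq_mul] at hx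
      have h2 := hΛΛ (Submodule.mul_mem_mul hu hx)
      rwa [Units.mul_inv_cancel_left] at h2
    · rw [mem_units_smul_submodule_iff, Units.smul_def, smul_eq_mul]
      exact hΛΛ (Submodule.mul_mem_mul hu' hx)

omit [∀ i, NumberField (L i)] in
/-- **`Λ_2^{unit} ⊆ Λ_1^{unit}` for orders `Λ_2 ⊆ Λ_1`** (the first map of (8.7)). [cite: HertlingLarabi2026, §8 Thm. 8.2 (e) («1 → Λ_2^unit → Λ_1^unit»), chunk p0021] -/
theorem stabilizer_le_stabilizer_of_le {Λ₁ Λ₂ : Submodule ℤ (Π i, L i)} (h1 : (1 : Π i, L i) ∈ Λ₁)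
    (hΛ₁Λ₁ : Λ₁ * Λ₁ ≤ Λ₁) (h2 : (1 : Π i, L i) ∈ Λ₂) (hΛ₂Λ₂ : Λ₂ * Λ₂ ≤ Λ₂) (hle : Λ₂ ≤ Λ₁) :
    MulAction.stabilizer (Π i, L i)ˣ Λ₂ ≤ MulAction.stabilizer (Π i, L i)ˣ Λ₁ := fun u hu => by
  rw [mem_stabilizer_iff_mem_and_inv_mem h2 hΛ₂Λ₂] at hu
  exact (mem_stabilizer_iff_mem_and_inv_mem h1 hΛ₁Λ₁ u).2 ⟨hle hu.1, hle hu.2⟩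

omit [∀ i, NumberField (L i)] in
/-- **`uK = K ⟺ u ∈ 𝒪(K)^{unit}`: the stabilizer of a lattice `K` with exact order `Λ` (an order) is `Λ^{unit}`.**
[cite: HertlingLarabi2026, §5 Lemma 5.5 and §8 Thm. 8.2 (e) proof («b/a_p ∈ (Λ_2)_(p)^unit … so b ∈ ⋂ (Λ_1)_(p)^unit = Λ_1^unit»), chunks p0012, p0023] -/
theorem stabilizer_eq_stabilizer_of_div_self_eq {Λ K : Submodule ℤ (Π i, L i)} (h1 : (1 : Π i, L i) ∈ Λ)
    (hΛΛ : Λ * Λ ≤ Λ) (hKO : K / K = Λ) :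
    MulAction.stabilizer (Π i, L i)ˣ K = MulAction.stabilizer (Π i, L i)ˣ Λ := by
  ext u
  rw [mem_stabilizer_iff_mem_and_inv_mem h1 hΛΛ, MulAction.mem_stabilizer_iff, ← hKO,
    Submodule.mem_div_iff_forall_mul_mem, Submodule.mem_div_iff_forall_mul_mem]
  constructor
  · intro h
    refine ⟨fun k hk => ?_, fun k hk => ?_⟩
    · rw [← h]
      exact Submodule.smul_mem_pointwise_smul _ _ _ hk
    · have h2 : k ∈ u • K := by rw [h]; exact hk
      rwa [mem_units_smul_submodule_iff, Units.smul_def, smul_eq_mul] at h2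
  · rintro ⟨hu, hu'⟩
    refine le_antisymm (fun x hx => ?_) (fun x hx => ?_)
    · rw [mem_units_smul_submodule_iff, Units.smul_def, smul_eq_mul] at hx
      have h2 := hu _ hx
      rwa [Units.mul_inv_cancel_left] at h2
    · rw [mem_units_smul_submodule_iff, Units.smul_def, smul_eq_mul]
      exact hu' x hx

/-! ## §2 The lattice kernel over the class kernel: fibres `≅ Λ_1^{unit}/Λ_2^{unit}` -/

omit [∀ i, NumberField (L i)] in
/-- **THEOREM 8.2 (e), the Claim, and (f): `#ker(G(Λ_2) → G(Λ_1)) = #ker(G([Λ_2]_ε) → G([Λ_1]_ε)) ·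
[Λ_1^{unit} : Λ_2^{unit}]`** for an order `Λ_2` and any lattice `Λ_1` of `Y` (HL: orders `Λ_2 ⊆ Λ_1`) — the map `K ↦ [K]_ε` from the lattice kernel ONTO the
class kernel («Claim: … is surjective»: `[K]_ε ∈ ker_ε`, `uΛ_1K = Λ_1`, has the representative `uK` in the
lattice kernel) has as fibres the orbits `{uK | u ∈ Λ_1^{unit}}` («`aΛ_2 ∈ [Λ_2]_ε`»), each in bijection with
`Λ_1^{unit}/Λ_2^{unit}` since `uK = K ⟺ u ∈ Λ_2^{unit}`.  Stated with `Nat.card` (both sides are `0` if infinite;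
in fact all three are finite, HL (f)). [cite: HertlingLarabi2026, §8 Thm. 8.2 (e) (exactness «Λ_1^unit → ∏(Λ_1)_(p)^unit/(Λ_2)_(p)^unit → G([Λ_2]_ε)» with (b), and the Claim), (f) (8.10), chunks p0021–p0023]
[cite: NeukirchANT1999, I §12 Thm. (12.12) (one field: the factor 1/[𝒪_K^* : 𝒪^*]), as identified by HertlingLarabi2026 Rem. 8.3] -/
theorem natCard_kerLat_eq_natCard_ker_mul_relIndex {Λ₁ Λ₂ : Submodule ℤ (Π i, L i)}
    (h2 : (1 : Π i, L i) ∈ Λ₂) (hΛ₂Λ₂ : Λ₂ * Λ₂ ≤ Λ₂) :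
    Nat.card {K : Submodule ℤ (Π i, L i) //
        ((IsFullLattice (Π i, L i) K ∧ K / K = Λ₂) ∧ K * ((K / K) / K) = K / K) ∧ Λ₁ * K = Λ₁} =
    Nat.card {q : Quot (fun M M' : {M : Submodule ℤ (Π i, L i) //
          (IsFullLattice (Π i, L i) M ∧ M / M = Λ₂) ∧ M * ((M / M) / M) = M / M} =>
        ∃ u : (Π i, L i)ˣ, u • (M : Submodule ℤ (Π i, L i)) = M') //
      ∃ M : {M : Submodule ℤ (Π i, L i) //
          (IsFullLattice (Π i, L i) M ∧ M / M = Λ₂) ∧ M * ((M / M) / M) = M / M},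
        Quot.mk _ M = q ∧ ∃ u : (Π i, L i)ˣ, u • (Λ₁ * M.1) = Λ₁} *
    (MulAction.stabilizer (Π i, L i)ˣ Λ₂).relIndex (MulAction.stabilizer (Π i, L i)ˣ Λ₁) := by
  classical
  have hE := IsCMAlgTorusRat.equivalence_exists_units_smul_eq (L := L)
    (fun M => (IsFullLattice (Π i, L i) M ∧ M / M = Λ₂) ∧ M * ((M / M) / M) = M / M)
  -- `uK ∈ G(Λ₂)` for `K ∈ G(Λ₂)`; `Λ₁(uK) = Λ₁ ⟺ u ∈ Λ₁^unit` when `Λ₁K = Λ₁`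
  have hsmulG : ∀ (u : (Π i, L i)ˣ) {K : Submodule ℤ (Π i, L i)},
      (IsFullLattice (Π i, L i) K ∧ K / K = Λ₂) ∧ K * ((K / K) / K) = K / K →
      (IsFullLattice (Π i, L i) (u • K) ∧ (u • K) / (u • K) = Λ₂) ∧
        (u • K) * (((u • K) / (u • K)) / (u • K)) = (u • K) / (u • K) := fun u K hK =>
    ⟨⟨isFullLattice_units_smul u hK.1.1, by rw [div_self_units_smul, hK.1.2]⟩, units_smul_mul_div_div_eq u hK.2⟩
  have hsmulker : ∀ (u : (Π i, L i)ˣ) {K : Submodule ℤ (Π i, L i)}, Λ₁ * K = Λ₁ →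
      (Λ₁ * (u • K) = Λ₁ ↔ u ∈ MulAction.stabilizer (Π i, L i)ˣ Λ₁) := fun u K hK => by
    rw [units_smul_order_mul, hK, MulAction.mem_stabilizer_iff]
  -- the projection `π : ker(G(Λ₂) → G(Λ₁)) → ker_ε`
  let π : {K : Submodule ℤ (Π i, L i) //
        ((IsFullLattice (Π i, L i) K ∧ K / K = Λ₂) ∧ K * ((K / K) / K) = K / K) ∧ Λ₁ * K = Λ₁} →
      {q : Quot (fun M M' : {M : Submodule ℤ (Π i, L i) //
            (IsFullLattice (Π i, L i) M ∧ M / M = Λ₂) ∧ M * ((M / M) / M) = M / M} =>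
          ∃ u : (Π i, L i)ˣ, u • (M : Submodule ℤ (Π i, L i)) = M') //
        ∃ M : {M : Submodule ℤ (Π i, L i) //
            (IsFullLattice (Π i, L i) M ∧ M / M = Λ₂) ∧ M * ((M / M) / M) = M / M},
          Quot.mk _ M = q ∧ ∃ u : (Π i, L i)ˣ, u • (Λ₁ * M.1) = Λ₁} :=
    fun K => ⟨Quot.mk _ ⟨K.1, K.2.1⟩, ⟨K.1, K.2.1⟩, rfl, 1, by rw [one_smul]; exact K.2.2⟩
  -- every fibre of `π` is in bijection with `Λ₁^unit/Λ₂^unit`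
  have hfib : ∀ q, Nonempty ({K // π K = q} ≃
      (MulAction.stabilizer (Π i, L i)ˣ Λ₁ ⧸
        (MulAction.stabilizer (Π i, L i)ˣ Λ₂).subgroupOf (MulAction.stabilizer (Π i, L i)ˣ Λ₁))) := by
    intro q
    -- a representative `K₀` of `q` in the lattice kernel (HL's Claim)
    obtain ⟨M, hMq, u, hu⟩ := q.2
    have hK₀ : ((IsFullLattice (Π i, L i) (u • M.1) ∧ (u • M.1) / (u • M.1) = Λ₂) ∧
        (u • M.1) * (((u • M.1) / (u • M.1)) / (u • M.1)) = (u • M.1) / (u • M.1)) ∧ Λ₁ * (u • M.1) = Λ₁ :=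
      ⟨hsmulG u M.2, by rw [units_smul_order_mul, hu]⟩
    let K₀ : {K : Submodule ℤ (Π i, L i) //
        ((IsFullLattice (Π i, L i) K ∧ K / K = Λ₂) ∧ K * ((K / K) / K) = K / K) ∧ Λ₁ * K = Λ₁} := ⟨u • M.1, hK₀⟩
    have hπK₀ : π K₀ = q := by
      apply Subtype.ext
      change Quot.mk _ ⟨u • M.1, hK₀.1⟩ = q.1
      rw [← hMq]
      exact (Quot.sound ⟨u, rfl⟩).symm
    -- `φ : Λ₁^unit/Λ₂^unit → fibre`, `v ↦ vK₀`
    have hwd : ∀ v w : MulAction.stabilizer (Π i, L i)ˣ Λ₁,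
        (QuotientGroup.leftRel ((MulAction.stabilizer (Π i, L i)ˣ Λ₂).subgroupOf
          (MulAction.stabilizer (Π i, L i)ˣ Λ₁))) v w → (v : (Π i, L i)ˣ) • (u • M.1) = (w : (Π i, L i)ˣ) • (u • M.1) := by
      intro v w hvw
      rw [QuotientGroup.leftRel_apply, Subgroup.mem_subgroupOf,
        ← stabilizer_eq_stabilizer_of_div_self_eq h2 hΛ₂Λ₂ hK₀.1.1.2, MulAction.mem_stabilizer_iff] at hvw
      have h := congrArg (fun N : Submodule ℤ (Π i, L i) => (v : (Π i, L i)ˣ) • N) hvw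
      rw [← mul_smul, Subgroup.coe_mul, Subgroup.coe_inv, mul_inv_cancel_left] at h
      exact h.symm
    let φ : (MulAction.stabilizer (Π i, L i)ˣ Λ₁ ⧸
        (MulAction.stabilizer (Π i, L i)ˣ Λ₂).subgroupOf (MulAction.stabilizer (Π i, L i)ˣ Λ₁)) →
        {K // π K = q} :=
      Quotient.lift (fun v : MulAction.stabilizer (Π i, L i)ˣ Λ₁ =>
          ⟨⟨(v : (Π i, L i)ˣ) • (u • M.1), hsmulG _ hK₀.1, (hsmulker _ hK₀.2).2 v.2⟩, by
            rw [← hπK₀]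
            apply Subtype.ext
            exact Quot.sound ⟨(v : (Π i, L i)ˣ)⁻¹, by
              change (v : (Π i, L i)ˣ)⁻¹ • ((v : (Π i, L i)ˣ) • (u • M.1)) = u • M.1
              rw [inv_smul_smul]⟩⟩)
        (fun v w hvw => by
          apply Subtype.ext; apply Subtype.ext
          exact hwd v w hvw)
    refine ⟨(Equiv.ofBijective φ ⟨fun x y hxy => ?_, fun K => ?_⟩).symm⟩
    · -- injective: `vK₀ = wK₀ ⟹ v⁻¹w ∈ stab(K₀) = Λ₂^unit`
      induction x using Quotient.inductionOn with | h v => ?_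
      induction y using Quotient.inductionOn with | h w => ?_
      have h : (v : (Π i, L i)ˣ) • (u • M.1) = (w : (Π i, L i)ˣ) • (u • M.1) :=
        congrArg (fun z : {K // π K = q} => (z.1.1 : Submodule ℤ (Π i, L i))) hxy
      have hvw : (QuotientGroup.leftRel ((MulAction.stabilizer (Π i, L i)ˣ Λ₂).subgroupOf
          (MulAction.stabilizer (Π i, L i)ˣ Λ₁))) v w := by
        rw [QuotientGroup.leftRel_apply, Subgroup.mem_subgroupOf,
          ← stabilizer_eq_stabilizer_of_div_self_eq h2 hΛ₂Λ₂ hK₀.1.1.2, MulAction.mem_stabilizer_iff,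
          Subgroup.coe_mul, Subgroup.coe_inv, mul_smul, ← h, inv_smul_smul]
      exact Quotient.sound hvw
    · -- surjective: `K` in the fibre of `q = [K₀]` is `vK₀` with `v ∈ Λ₁^unit`
      have hKq : Quot.mk (fun M M' : {M : Submodule ℤ (Π i, L i) //
            (IsFullLattice (Π i, L i) M ∧ M / M = Λ₂) ∧ M * ((M / M) / M) = M / M} =>
          ∃ u : (Π i, L i)ˣ, u • (M : Submodule ℤ (Π i, L i)) = M') ⟨u • M.1, hK₀.1⟩ =
          Quot.mk _ ⟨K.1.1, K.1.2.1⟩ := by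
        have h := congrArg Subtype.val ((hπK₀).trans K.2.symm)
        exact h
      obtain ⟨v, hv⟩ := hE.eqvGen_iff.1 (Quot.eqvGen_exact hKq)
      change v • (u • M.1) = K.1.1 at hv
      have hv₁ : v ∈ MulAction.stabilizer (Π i, L i)ˣ Λ₁ := by
        rw [← hsmulker v hK₀.2, hv]
        exact K.1.2.2
      refine ⟨Quotient.mk _ ⟨v, hv₁⟩, ?_⟩
      apply Subtype.ext; apply Subtype.ext
      exact hv
  -- count: `ker ≃ Σ_q fibre ≃ ker_ε × Λ₁^unit/Λ₂^unit`
  rw [Nat.card_congr (Equiv.sigmaFiberEquiv π).symm,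
    Nat.card_congr (Equiv.sigmaCongrRight fun q => (hfib q).some), Nat.card_congr (Equiv.sigmaEquivProd _ _),
    Nat.card_prod, Subgroup.relIndex, Subgroup.index]

/-! ## §3 `(Λ_1/C)^{unit}/(Λ_2/C)^{unit}` counts the lattice kernel (Thm. 8.2 (d), g32-#5/#7) -/

/-- **THEOREM 8.2 (d), counting form: `#((Λ_1/C)^{unit}/(Λ_2/C)^{unit}) = #ker(G(Λ_2) → G(Λ_1))`** for orders
`Λ_2 ⊆ Λ_1` of `Y`, `C = Λ_2:Λ_1` — the bijection (8.6) `a ↦ C + aΛ_2` (well defined: g32-#5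
`conductor_sup_map_mulLeft_mem_ker`; fibres: g32-#7 `conductor_sup_map_mulLeft_eq_iff`; onto: g32-#7
`exists_eq_conductor_sup_map_mulLeft`), with `(Λ_1/C)^{unit}/(Λ_2/C)^{unit}` written as the `Quot` of
`{a ∈ Λ_1 | a + C ∈ (Λ_1/C)^{unit}}` by `a ∼ b :⟺ b ≡ av (mod C)` for some `v ∈ Λ_2` with `v + C ∈ (Λ_2/C)^{unit}`.
[cite: HertlingLarabi2026, §8 Thm. 8.2 (d) (the isomorphism (8.6)), chunks p0021–p0022] -/
theorem natCard_quot_unitsModConductor_eq_natCard_kerLat {Λ₁ Λ₂ : Submodule ℤ (Π i, L i)}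
    (hΛ₁ : IsFullLattice (Π i, L i) Λ₁) (h1 : (1 : Π i, L i) ∈ Λ₁) (hΛ₁Λ₁ : Λ₁ * Λ₁ ≤ Λ₁)
    (hΛ₂ : IsFullLattice (Π i, L i) Λ₂) (h2 : (1 : Π i, L i) ∈ Λ₂) (hΛ₂Λ₂ : Λ₂ * Λ₂ ≤ Λ₂) (hle : Λ₂ ≤ Λ₁) :
    Nat.card (Quot (fun a b : {a : Π i, L i // a ∈ Λ₁ ∧ ∃ a' ∈ Λ₁, a * a' - 1 ∈ Λ₂ / Λ₁} =>
        ∃ v ∈ Λ₂, (∃ v' ∈ Λ₂, v * v' - 1 ∈ Λ₂ / Λ₁) ∧ (b : Π i, L i) - a * v ∈ Λ₂ / Λ₁)) =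
    Nat.card {K : Submodule ℤ (Π i, L i) //
        ((IsFullLattice (Π i, L i) K ∧ K / K = Λ₂) ∧ K * ((K / K) / K) = K / K) ∧ Λ₁ * K = Λ₁} := by
  classical
  have hmem : ∀ a : {a : Π i, L i // a ∈ Λ₁ ∧ ∃ a' ∈ Λ₁, a * a' - 1 ∈ Λ₂ / Λ₁},
      ((IsFullLattice (Π i, L i) (Λ₂ / Λ₁ ⊔ Λ₂.map (LinearMap.mulLeft ℤ (a : Π i, L i))) ∧
        (Λ₂ / Λ₁ ⊔ Λ₂.map (LinearMap.mulLeft ℤ (a : Π i, L i))) /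
          (Λ₂ / Λ₁ ⊔ Λ₂.map (LinearMap.mulLeft ℤ (a : Π i, L i))) = Λ₂) ∧
        (Λ₂ / Λ₁ ⊔ Λ₂.map (LinearMap.mulLeft ℤ (a : Π i, L i))) *
          (((Λ₂ / Λ₁ ⊔ Λ₂.map (LinearMap.mulLeft ℤ (a : Π i, L i))) /
            (Λ₂ / Λ₁ ⊔ Λ₂.map (LinearMap.mulLeft ℤ (a : Π i, L i)))) /
            (Λ₂ / Λ₁ ⊔ Λ₂.map (LinearMap.mulLeft ℤ (a : Π i, L i)))) =
          (Λ₂ / Λ₁ ⊔ Λ₂.map (LinearMap.mulLeft ℤ (a : Π i, L i))) /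
            (Λ₂ / Λ₁ ⊔ Λ₂.map (LinearMap.mulLeft ℤ (a : Π i, L i)))) ∧
      Λ₁ * (Λ₂ / Λ₁ ⊔ Λ₂.map (LinearMap.mulLeft ℤ (a : Π i, L i))) = Λ₁ := fun a => by
    obtain ⟨a', ha', haa'⟩ := a.2.2
    have h := conductor_sup_map_mulLeft_mem_ker hΛ₁ h1 hΛ₁Λ₁ hΛ₂ h2 hΛ₂Λ₂ hle a.2.1 ha' haa'
    exact ⟨⟨⟨h.1, h.2.1⟩, h.2.2.1⟩, h.2.2.2⟩
  let ψ : Quot (fun a b : {a : Π i, L i // a ∈ Λ₁ ∧ ∃ a' ∈ Λ₁, a * a' - 1 ∈ Λ₂ / Λ₁} =>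
        ∃ v ∈ Λ₂, (∃ v' ∈ Λ₂, v * v' - 1 ∈ Λ₂ / Λ₁) ∧ (b : Π i, L i) - a * v ∈ Λ₂ / Λ₁) →
      {K : Submodule ℤ (Π i, L i) //
        ((IsFullLattice (Π i, L i) K ∧ K / K = Λ₂) ∧ K * ((K / K) / K) = K / K) ∧ Λ₁ * K = Λ₁} :=
    Quot.lift (fun a => ⟨Λ₂ / Λ₁ ⊔ Λ₂.map (LinearMap.mulLeft ℤ (a : Π i, L i)), hmem a⟩)
      fun a b hab => Subtype.ext ((conductor_sup_map_mulLeft_eq_iff h1 hΛ₁Λ₁ h2 hΛ₂Λ₂ hle a.2.1 a.2.2).2 hab)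
  have hψ : ∀ a, ψ (Quot.mk _ a) = ⟨Λ₂ / Λ₁ ⊔ Λ₂.map (LinearMap.mulLeft ℤ (a : Π i, L i)), hmem a⟩ := fun a => rfl
  refine Nat.card_congr (Equiv.ofBijective ψ ⟨fun x y hxy => ?_, fun K => ?_⟩)
  · induction x using Quot.ind with | mk a => ?_
    induction y using Quot.ind with | mk b => ?_
    rw [hψ, hψ] at hxy
    exact Quot.sound ((conductor_sup_map_mulLeft_eq_iff h1 hΛ₁Λ₁ h2 hΛ₂Λ₂ hle a.2.1 a.2.2).1
      (congrArg Subtype.val hxy))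
  · obtain ⟨a, haΛ₁, hau, hK⟩ :=
      exists_eq_conductor_sup_map_mulLeft hΛ₁ h1 hΛ₁Λ₁ hΛ₂ h2 hΛ₂Λ₂ hle K.2.1.1.1 K.2.1.1.2 K.2.1.2 K.2.2
    exact ⟨Quot.mk _ ⟨a, haΛ₁, hau⟩, Subtype.ext hK.symm⟩

/-! ## §4 The counting form of (8.10): `#G([Λ_2]_ε)·[Λ_1^{unit} : Λ_2^{unit}] = #G([Λ_1]_ε)·#((Λ_1/C)^{unit}/(Λ_2/C)^{unit})` -/

/-- **THEOREM 8.2 (f) (8.10), the CLASS NUMBER FORMULA for a pair of orders `Λ_2 ⊆ Λ_1` of a CM-algebra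
`Y = ∏ L_i`, `C = Λ_2:Λ_1`: `#G([Λ_2]_ε) · [Λ_1^{unit} : Λ_2^{unit}] = #G([Λ_1]_ε) · #((Λ_1/C)^{unit}/(Λ_2/C)^{unit})`**
(«`|G([Λ_2]_ε)|/|G([Λ_1]_ε)| = |(Λ_1/C)^{unit}|/|(Λ_2/C)^{unit}| · 1/[Λ_1^{unit} : Λ_2^{unit}]`»; Neukirch (12.12)
for `Λ_1 = 𝒪_K` in one field: `h(𝒪) = h_K/[𝒪_K^* : 𝒪^*] · #(𝒪_K/𝔣)^*/#(𝒪/𝔣)^*`) — assembled from g32-#6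
(`#G([Λ_2]_ε) = #G([Λ_1]_ε)·#ker_ε`), §2 (`#ker = #ker_ε·[Λ_1^{unit} : Λ_2^{unit}]`) and §3 (`#ker =
#((Λ_1/C)^{unit}/(Λ_2/C)^{unit})`); all factors are `Nat.card`s of the g32-#1/#6 `Quot` types and a `relIndex`.
[cite: HertlingLarabi2026, §8 Thm. 8.2 (f) (8.10), chunks p0021, p0023]
[cite: NeukirchANT1999, I §12 Thm. (12.12), as identified by HertlingLarabi2026 Rem. 8.3 («Theorem (12.12) in [Ne99] is a special case of part (f)»)] -/
theorem natCard_quot_pic_mul_relIndex_eq [Fintype t] {Λ₁ Λ₂ : Submodule ℤ (Π i, L i)}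
    (hΛ₁ : IsFullLattice (Π i, L i) Λ₁) (h1 : (1 : Π i, L i) ∈ Λ₁) (hΛ₁Λ₁ : Λ₁ * Λ₁ ≤ Λ₁)
    (hΛ₂ : IsFullLattice (Π i, L i) Λ₂) (h2 : (1 : Π i, L i) ∈ Λ₂) (hΛ₂Λ₂ : Λ₂ * Λ₂ ≤ Λ₂) (hle : Λ₂ ≤ Λ₁) :
    Nat.card (Quot (fun M M' : {M : Submodule ℤ (Π i, L i) //
        (IsFullLattice (Π i, L i) M ∧ M / M = Λ₂) ∧ M * ((M / M) / M) = M / M} =>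
      ∃ u : (Π i, L i)ˣ, u • (M : Submodule ℤ (Π i, L i)) = M')) *
      (MulAction.stabilizer (Π i, L i)ˣ Λ₂).relIndex (MulAction.stabilizer (Π i, L i)ˣ Λ₁) =
    Nat.card (Quot (fun M M' : {M : Submodule ℤ (Π i, L i) //
        (IsFullLattice (Π i, L i) M ∧ M / M = Λ₁) ∧ M * ((M / M) / M) = M / M} =>
      ∃ u : (Π i, L i)ˣ, u • (M : Submodule ℤ (Π i, L i)) = M')) *
    Nat.card (Quot (fun a b : {a : Π i, L i // a ∈ Λ₁ ∧ ∃ a' ∈ Λ₁, a * a' - 1 ∈ Λ₂ / Λ₁} =>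
        ∃ v ∈ Λ₂, (∃ v' ∈ Λ₂, v * v' - 1 ∈ Λ₂ / Λ₁) ∧ (b : Π i, L i) - a * v ∈ Λ₂ / Λ₁)) := by
  rw [natCard_quot_pic_eq_natCard_quot_pic_mul_natCard_ker hΛ₁ h1 hΛ₁Λ₁ hΛ₂ h2 hΛ₂Λ₂ hle,
    natCard_quot_unitsModConductor_eq_natCard_kerLat hΛ₁ h1 hΛ₁Λ₁ hΛ₂ h2 hΛ₂Λ₂ hle,
    natCard_kerLat_eq_natCard_ker_mul_relIndex h2 hΛ₂Λ₂, mul_assoc]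

end KernelUnitIndex

end Literature.NumberTheory.ComplexMultiplication
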